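import Mathlib
import HarnessLib
import Summits.Ventures.LatticeQCDFlow.Exactness.SUNExpChart
import Summits.Ventures.LatticeQCDFlow.Exactness.SUNKickCoordinates
import Summits.Ventures.LatticeQCDFlow.Exactness.HaarSteinSpecialUnitary
import Summits.Ventures.LatticeQCDFlow.Scoring.WilsonStapleSum

/-!
# The engine's `SU(N)` Wilson force IS the exact derivative of its action along the drift: `d/dt|₀ (β/N)·S_W(e^{tX} ·_e U) = −2 Re tr (X · F(U)_e)`

HONEST FRAMING: exact (Metropolis-corrected) sampling algorithms for lattice gauge theory;
figures of merit are autocorrelation/cost numbers at stated couplings and volumes; no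
continuum-physics claim.

Venture `LatticeQCDFlow` (cell pub-lqcd), topic `Exactness`, FANOUT row 9 (eng-latcore, the
engine `latflow.core.hmc`: `H = −tr P² + S(U)`, `S(U) = β Σ_p (1 − Re tr U_p/N) = (β/N)·S_W(U)`, drift
`U_e ← exp(εP_e) U_e`, kicks `P ← P − c·F(U)`, `F(U)_e = (β/2N)·TA(U_e R_e(U))`).  NEW WORK of the cell
over the tree (`SUNKickCoordinates.lean` / `SUNExpChart.lean`: the coordinates `ι = sunCoordι N` of
`𝔰𝔲(N)` and `suExp`; row 16's
`Scoring/WilsonStapleSum.lean`: the exact local action difference `S_W(h ·_e U) − S_W(U) =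
Re tr (U_e R_e) − Re tr (h U_e R_e)`, `L ≥ 2`) and `HaarSteinSpecialUnitary.lean` (`d/dt Re tr (e^{tX} M) = Re tr (X e^{tX} M)`); the
Literature's `suProj = TA`, `wilsonAction`, `fundamentalRep` are used by name; nothing is cited as a fact.
This is the `SU(N)` counterpart of row 14's `SU2ExactForceWilson.lean` (there: Pauli coordinates, the
quaternion routine); no number is claimed.

THE POINT.  `SUNWilsonForce.lean` proved convergence of the engine's HMC for ANY smooth force and typed
the engine's routine `F`; what makes `F` THE molecular-dynamics force of `H = −Σ tr P_e² + (β/N)·S_W` —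
the identity behind `⟨e^{−ΔH}⟩ = 1` and the acceptance rate, irrelevant for exactness and convergence —
is that the derivative of the action along every drift direction `X = ι c ∈ 𝔰𝔲(N)` at the link `e` is
`−2 Re tr (X · ι F(U)_e) = 2⟨c, F(U)_e⟩` for the pairing `⟨c, c'⟩ = −Re tr (ι c · ι c')` whose quadratic
form is the kinetic term `−tr P²`; with `U̇_e = P_e U_e` and `Ṗ_e = −ι F(U)_e` (the kick `P ← P − εF`) the
energy `H` is then conserved along the exact flow: `dH/dt = Σ_e (2⟨P_e, Ṗ_e⟩ + 2⟨P_e, F_e⟩) = 0`.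

* §1 `re_trace_mul_eq_re_trace_mul_suProj` — for `X† = −X`, `tr X = 0`: `Re tr (X W) = Re tr (X · TA(W))`
  (the Hermitian and scalar parts of `W` are `Re tr`-orthogonal to `𝔰𝔲(N)`; the Literature's
  `re_trace_suProj_mul` is the case `X = TA(W)`).
* §2 `engineWilsonAction_mulSingle_suExp` — along the one-link drift `t ↦ e^{t ι c} ·_e U` the engine's
  action is `t ↦ (β/N)(S_W(U) + Re tr (U_e R_e) − Re tr (e^{t ι c} U_e R_e))` (`L ≥ 2`);
  the tree's `hasDerivAt_re_trace_exp_smul_mul` (`HaarSteinSpecialUnitary.lean`) differentiates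
  `t ↦ Re tr (e^{tX} M)`.
* §3 **`hasDerivAt_engineWilsonAction_drift`** — for `N ≥ 1`, `L ≥ 2`, every `β`, configuration `U`,
  link `e` and coordinate vector `c`:
  `HasDerivAt (t ↦ (β/N)·S_W(suExp (t•c) ·_e U)) (−2 Re tr (ι c · (β/2N)·TA(U_e R_e(U)))) 0` — THE
  ENGINE'S FORCE MATRIX `(β/2N)·TA(U_e R_e(U))` (`= ι F_β(U)_e`, `SUNWilsonForce.sunCoordι_sunWilsonForce_eq_staple`)
  IS THE EXACT GRADIENT OF ITS ACTION for the kinetic pairing (sign = the kick `P ← P − εF`).  This file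
  is independent of `SUNWilsonForce.lean` (no definition is introduced).

NOT CLAIMED: `L = 1` (a plaquette is then a commutator in its own link and the staple form fails);
second derivatives / the shadow Hamiltonian; `⟨e^{−ΔH}⟩ = 1` as a typed statement (it is the exactness
theorem of the kernel files in another guise); plaquette weights; floating point.
-/

noncomputable section

namespace Summit.Ventures.LatticeQCDFlow.Exactness

open MeasureTheory Set Function NormedSpace
open Literature.MathematicalPhysics.QuantumFieldTheory
open Literature.MathematicalPhysics.QuantumLattice (fundamentalRep fundamentalRep_apply continuous_fundamentalRep)
open scoped Matrix

/-! ## §1 `Re tr (X W) = Re tr (X · TA(W))` on `𝔰𝔲(N)` -/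

section Trace

variable {N : ℕ}

/-- For `X ∈ 𝔰𝔲(N)` (`X† = −X`, `tr X = 0`) and any `W`: **`Re tr (X W) = Re tr (X · TA(W))`** — the Hermitian
part `(W + W†)/2` and the scalar part `tr(W − W†)/(2N)·1` of `W` are `Re tr`-orthogonal to `X`. -/
theorem re_trace_mul_eq_re_trace_mul_suProj {X : Matrix (Fin N) (Fin N) ℂ} (hX : Xᴴ = -X) (htr : X.trace = 0)
    (W : Matrix (Fin N) (Fin N) ℂ) : (X * W).trace.re = (X * suProj W).trace.re := by
  set H : Matrix (Fin N) (Fin N) ℂ := (1 / 2 : ℂ) • (W + Wᴴ) with hH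
  set c : ℂ := (1 / (2 * N) : ℂ) * (W - Wᴴ).trace with hc
  have hdec : W = suProj W + (H + c • (1 : Matrix (Fin N) (Fin N) ℂ)) := by
    simp only [suProj, hH, hc, smul_sub, smul_add]
    module
  have hHh : Hᴴ = H := by
    have h2 : star (1 / 2 : ℂ) = 1 / 2 := by norm_num [Complex.ext_iff]
    rw [hH, Matrix.conjTranspose_smul, Matrix.conjTranspose_add, Matrix.conjTranspose_conjTranspose, add_comm, h2]
  have hherm : (X * H).trace.re = 0 := by
    have key : star (X * H).trace = -(X * H).trace := by
      rw [← Matrix.trace_conjTranspose, Matrix.conjTranspose_mul, hHh, hX, Matrix.mul_neg, Matrix.trace_neg,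
        Matrix.trace_mul_comm]
    have h := congrArg Complex.re key
    rw [Complex.star_def, Complex.conj_re, Complex.neg_re] at h
    linarith
  have hscal : (X * (c • (1 : Matrix (Fin N) (Fin N) ℂ))).trace.re = 0 := by
    rw [Matrix.mul_smul, Matrix.mul_one, Matrix.trace_smul, htr, smul_zero, Complex.zero_re]
  conv_lhs => rw [hdec]
  rw [Matrix.mul_add, Matrix.mul_add, Matrix.trace_add, Matrix.trace_add, Complex.add_re, Complex.add_re, hherm,
    hscal, add_zero, add_zero]

end Trace

/-! ## §2 The action along a one-link drift -/

section Drift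

variable (N : ℕ) {d L : ℕ} [NeZero L]

/-- **The engine's action along the one-link drift** `t ↦ e^{t ι c} ·_e U` (`L ≥ 2`):
`(β/N)·S_W(suExp (t•c) ·_e U) = (β/N)(S_W(U) + Re tr (U_e R_e) − Re tr (e^{t ι c} U_e R_e))` with row 16's
staple sum `R_e = R_e(U)` (which does not contain the link `e`). -/
theorem engineWilsonAction_mulSingle_suExp (hL : 2 ≤ L) (β : ℝ)
    (U : GaugeConfig d L (Matrix.specialUnitaryGroup (Fin N) ℂ)) (e : Edge d L) (c : SUNCoords N) (t : ℝ) :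
    β / N * wilsonAction (fundamentalRep (Fin N))
        (Pi.mulSingle e (suExp (sunCoordι N) (sunCoordι_skew N) (t • c)) * U) =
      β / N * (wilsonAction (fundamentalRep (Fin N)) U +
        ((((U e : Matrix.specialUnitaryGroup (Fin N) ℂ) : Matrix (Fin N) (Fin N) ℂ) *
            Scoring.stapleSum (fundamentalRep (Fin N)) U e.1 e.2).trace).re -
        ((exp (t • sunCoordι N c) * ((((U e : Matrix.specialUnitaryGroup (Fin N) ℂ) : Matrix (Fin N) (Fin N) ℂ) *
            Scoring.stapleSum (fundamentalRep (Fin N)) U e.1 e.2))).trace).re) := by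
  have h := Scoring.wilsonAction_mulSingle_sub (fundamentalRep (Fin N)) hL (continuous_fundamentalRep (Fin N)) U
    e.1 e.2 (suExp (sunCoordι N) (sunCoordι_skew N) (t • c))
  rw [Prod.mk.eta, fundamentalRep_apply, fundamentalRep_apply, WilsonFlow.coe_mul_SU, coe_suExp,
    LinearMap.map_smul, Matrix.mul_assoc] at h
  congr 1
  linarith

/-- The value of the derivative: `(β/N)(0 − Re tr (X e^{0} M)) = −2 Re tr (X · (β/2N)·TA(M))` for `X ∈ 𝔰𝔲(N)`. -/
theorem engineForce_deriv_value [NeZero N] {X : Matrix (Fin N) (Fin N) ℂ} (hX : Xᴴ = -X) (htr : X.trace = 0)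
    (β : ℝ) (M : Matrix (Fin N) (Fin N) ℂ) :
    β / N * (0 - ((X * exp ((0 : ℝ) • X) * M).trace).re) =
      -2 * ((X * ((β / (2 * N)) • suProj M)).trace).re := by
  have hN : (N : ℝ) ≠ 0 := Nat.cast_ne_zero.2 (NeZero.ne N)
  rw [zero_smul, exp_zero, Matrix.mul_one, Matrix.mul_smul, Matrix.trace_smul, Complex.smul_re,
    ← re_trace_mul_eq_re_trace_mul_suProj hX htr, smul_eq_mul]
  field_simp
  ring

end Drift

/-! ## §3 The force is the exact gradient -/

section Gradient

variable (N : ℕ) [NeZero N] {d L : ℕ} [NeZero L]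

/-- **THE ENGINE'S `SU(N)` WILSON FORCE IS THE EXACT DERIVATIVE OF ITS ACTION ALONG THE DRIFT.**  Torus
`(ℤ/L)^d` with `L ≥ 2`, `N ≥ 1`, any real `β`, any configuration `U`, link `e` and coordinate vector `c`
of `𝔰𝔲(N)` (`X = ι c`): the engine's action `(β/N)·S_W` along the one-link drift `t ↦ e^{tX} ·_e U`
has derivative `−2 Re tr (X · (β/2N)·TA(U_e R_e(U)))` at `t = 0` — `(β/2N)·TA(U_e R_e(U))` being the
engine's force matrix (`= ι (sunWilsonForce N β U e)` by `SUNWilsonForce.sunCoordι_sunWilsonForce_eq_staple`).  Since the kinetic term is `−tr P² = ⟨p, p⟩` for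
`⟨c, c'⟩ = −Re tr (ι c · ι c')`, this says `dS = 2⟨·, F⟩`: the kick `P ← P − εF` is the molecular-dynamics
force of `H = −Σ tr P_e² + (β/N)·S_W`. -/
theorem hasDerivAt_engineWilsonAction_drift (hL : 2 ≤ L) (β : ℝ)
    (U : GaugeConfig d L (Matrix.specialUnitaryGroup (Fin N) ℂ)) (e : Edge d L) (c : SUNCoords N) :
    HasDerivAt (fun t : ℝ => β / N * wilsonAction (fundamentalRep (Fin N))
        (Pi.mulSingle e (suExp (sunCoordι N) (sunCoordι_skew N) (t • c)) * U))
      (-2 * ((sunCoordι N c * ((β / (2 * N)) • suProj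
        (((U e : Matrix.specialUnitaryGroup (Fin N) ℂ) : Matrix (Fin N) (Fin N) ℂ) *
          Scoring.stapleSum (fundamentalRep (Fin N)) U e.1 e.2))).trace).re) 0 := by
  have hfun : (fun t : ℝ => β / N * wilsonAction (fundamentalRep (Fin N))
        (Pi.mulSingle e (suExp (sunCoordι N) (sunCoordι_skew N) (t • c)) * U)) =
      fun t : ℝ => β / N * (wilsonAction (fundamentalRep (Fin N)) U +
        ((((U e : Matrix.specialUnitaryGroup (Fin N) ℂ) : Matrix (Fin N) (Fin N) ℂ) *
            Scoring.stapleSum (fundamentalRep (Fin N)) U e.1 e.2).trace).re -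
        ((exp (t • sunCoordι N c) * ((((U e : Matrix.specialUnitaryGroup (Fin N) ℂ) : Matrix (Fin N) (Fin N) ℂ) *
            Scoring.stapleSum (fundamentalRep (Fin N)) U e.1 e.2))).trace).re) :=
    funext fun t => engineWilsonAction_mulSingle_suExp N hL β U e c t
  rw [hfun, ← engineForce_deriv_value N (sunCoordι_skew N c).1 (sunCoordι_skew N c).2 β]
  exact ((hasDerivAt_const (0 : ℝ) _).sub (hasDerivAt_re_trace_exp_smul_mul _ _ 0)).const_mul (β / N)

end Gradient

end Summit.Ventures.LatticeQCDFlow.Exactness
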